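import Summits.Parity.BatemanHorn.Theorems.SoloInformedHooleyShiftHypothesis
import Literature.Topology.FourManifolds.CollarUniquenessBall

/-!
# The weights of the trilinear form: size `≍ 1/m` and total variation `≍ 1/m` in the modulus

Informed soloist `solo-Parity-informed` (session 142), conjunct `BatemanHorn`, the `d ≥ 3` rung BELOW the parity
wall; sequel to `SoloInformedHooleyShiftHypothesis`.  Two elementary inputs for the Abel summation in the modulus
`e` that turns `HooleyShiftUniform` into a bound for the folded trilinear form:

* `exists_abs_log_natAbs_succ_sub_le`: for `g` irreducible of degree `d ≥ 2`,
  `|log|g(m+1)| − log|g(m)|| ≤ C_g/m` (`m ≥ 1`) — so the `m`-differences `Δa_e(m) = a_e(m+1) − a_e(m)` of the smooth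
  weights are `≤ C_g/(4Δm)` uniformly in `e` (`abs_locWeight_sub_le`);
* `sum_abs_locWeight_sub_diff_le`: for any two indices `m, m'` the function `e ↦ a_e(m') − a_e(m)` is UNIMODAL on
  `e ≥ 1` (a sliding-window overlap `clamp(t+σ) − clamp(t)` of the decreasing parameter `t = (Δ − log(e/√|g(m)|))/2Δ`),
  hence its total variation over any range of moduli is at most `3·sup ≤ 3|log|g(m')| − log|g(m)||/(4Δ)`: the
  smoothing in `e` costs NO more than the size — this is what the clamp partition of `SoloInformedSmoothHyperbola`
  was designed for (a sharp cutoff has variation `≍ 1`, losing the factor `1/m`).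
-/

namespace Summit.Parity.BatemanHorn.Theorems

open Finset Polynomial Filter Topology

/-! ### `|log|g(m+1)| − log|g(m)|| ≪ 1/m` -/

/-- `x^i − y^i ≤ i·x^{i−1}` for `0 ≤ y ≤ x`, `y + 1 = x`... in the form needed: `(m+1)^i − m^i ≤ i·(m+1)^{i−1}`.
[folklore] -/
theorem pow_succ_sub_pow_le (m i : ℕ) :
    ((m : ℝ) + 1) ^ i - (m : ℝ) ^ i ≤ i * ((m : ℝ) + 1) ^ (i - 1) := by
  have h := geom_sum₂_mul ((m : ℝ) + 1) (m : ℝ) i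
  rw [show ((m : ℝ) + 1 - m) = 1 by ring, mul_one] at h
  rw [← h]
  calc ∑ j ∈ range i, ((m : ℝ) + 1) ^ j * (m : ℝ) ^ (i - 1 - j)
      ≤ ∑ _j ∈ range i, ((m : ℝ) + 1) ^ (i - 1) := by
        refine sum_le_sum fun j hj => ?_
        rw [mem_range] at hj
        calc ((m : ℝ) + 1) ^ j * (m : ℝ) ^ (i - 1 - j)
            ≤ ((m : ℝ) + 1) ^ j * ((m : ℝ) + 1) ^ (i - 1 - j) :=
              mul_le_mul_of_nonneg_left (pow_le_pow_left₀ (by positivity) (by linarith) _) (by positivity)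
          _ = ((m : ℝ) + 1) ^ (i - 1) := by rw [← pow_add]; congr 1; omega
    _ = i * ((m : ℝ) + 1) ^ (i - 1) := by rw [sum_const, card_range, nsmul_eq_mul]

/-- `0 ≤ (m+1)^i − m^i`. [folklore] -/
theorem pow_succ_sub_pow_nonneg (m i : ℕ) : 0 ≤ ((m : ℝ) + 1) ^ i - (m : ℝ) ^ i :=
  sub_nonneg.mpr (pow_le_pow_left₀ (by positivity) (by linarith) _)

/-- The coefficient size `‖g‖₁ = ∑_i |a_i|`. [folklore] -/
noncomputable def coeffAbsSum (g : ℤ[X]) : ℝ :=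
  ∑ i ∈ range (g.natDegree + 1), |(g.coeff i : ℝ)|

/-- **Polynomial increments**: `|g(m+1) − g(m)| ≤ d·‖g‖₁·(m+1)^{d−1}`. [folklore] -/
theorem abs_eval_succ_sub_eval_le (g : ℤ[X]) (m : ℕ) :
    |((g.eval ((m : ℤ) + 1) : ℤ) : ℝ) - ((g.eval (m : ℤ) : ℤ) : ℝ)|
      ≤ g.natDegree * coeffAbsSum g * ((m : ℝ) + 1) ^ (g.natDegree - 1) := by
  have hdiff : ((g.eval ((m : ℤ) + 1) : ℤ) : ℝ) - ((g.eval (m : ℤ) : ℤ) : ℝ)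
      = ∑ i ∈ range (g.natDegree + 1), (g.coeff i : ℝ) * (((m : ℝ) + 1) ^ i - (m : ℝ) ^ i) := by
    rw [eval_eq_sum_range, eval_eq_sum_range]
    push_cast
    rw [← sum_sub_distrib]
    exact sum_congr rfl fun i _ => by ring
  rw [hdiff]
  refine (abs_sum_le_sum_abs _ _).trans ?_
  unfold coeffAbsSum
  rw [mul_sum, sum_mul]
  refine sum_le_sum fun i hi => ?_
  rw [mem_range] at hi
  rw [abs_mul, abs_of_nonneg (pow_succ_sub_pow_nonneg m i)]
  have h1 := pow_succ_sub_pow_le m i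
  have h2 : (i : ℝ) * ((m : ℝ) + 1) ^ (i - 1) ≤ g.natDegree * ((m : ℝ) + 1) ^ (g.natDegree - 1) := by
    refine mul_le_mul (by exact_mod_cast (by omega : i ≤ g.natDegree))
      (pow_le_pow_right₀ (by linarith [(Nat.cast_nonneg m : (0 : ℝ) ≤ m)]) (by omega)) (by positivity)
      (Nat.cast_nonneg _)
  calc |(g.coeff i : ℝ)| * (((m : ℝ) + 1) ^ i - (m : ℝ) ^ i)
      ≤ |(g.coeff i : ℝ)| * (g.natDegree * ((m : ℝ) + 1) ^ (g.natDegree - 1)) :=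
        mul_le_mul_of_nonneg_left (h1.trans h2) (abs_nonneg _)
    _ = g.natDegree * |(g.coeff i : ℝ)| * ((m : ℝ) + 1) ^ (g.natDegree - 1) := by ring


/-- **`|log|g(m+1)| − log|g(m)|| ≤ C_g/m`** for `g` irreducible of degree `d ≥ 2` and all `m ≥ 1`
(`|g(m+1) − g(m)| ≪ m^{d−1}` against `|g(m)|, |g(m+1)| ≫ m^d`). [this work] -/
theorem exists_abs_log_natAbs_succ_sub_le {g : ℤ[X]} (hirr : Irreducible g) (hdeg : 2 ≤ g.natDegree) :
    ∃ C : ℝ, ∀ m : ℕ, 1 ≤ m →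
      |Real.log ((g.eval ((m : ℤ) + 1)).natAbs : ℝ) - Real.log ((g.eval (m : ℤ)).natAbs : ℝ)| ≤ C / m := by
  obtain ⟨B, hB⟩ := exists_abs_log_natAbs_eval_sub_le (g := g) (by omega)
  set d : ℕ := g.natDegree with hd
  set A : ℝ := d * coeffAbsSum g with hA
  have hA0 : 0 ≤ A := by
    have : 0 ≤ coeffAbsSum g := sum_nonneg fun _ _ => abs_nonneg _
    positivity
  refine ⟨A * Real.exp B * 2 ^ (d - 1), fun m hm => ?_⟩
  have hm0 : (0 : ℝ) < m := by exact_mod_cast hm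
  have hz : ∀ k : ℕ, g.eval (k : ℤ) ≠ 0 := fun k => eval_natCast_ne_zero_of_irreducible hirr hdeg k
  -- the two values as reals
  have hNpos : ∀ k : ℕ, (0 : ℝ) < ((g.eval (k : ℤ)).natAbs : ℝ) := fun k => by
    exact_mod_cast Nat.pos_of_ne_zero (Int.natAbs_ne_zero.mpr (hz k))
  -- lower bounds `|g(k)| ≥ e^{−B} k^d`
  have hlow : ∀ k : ℕ, 1 ≤ k → Real.exp (-B) * (k : ℝ) ^ d ≤ ((g.eval (k : ℤ)).natAbs : ℝ) := by
    intro k hk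
    have hk0 : (0 : ℝ) < k := by exact_mod_cast hk
    have h1 := (abs_le.mp (hB k hk)).1
    calc Real.exp (-B) * (k : ℝ) ^ d = Real.exp (-B + d * Real.log k) := by
          rw [Real.exp_add, ← Real.log_pow, Real.exp_log (pow_pos hk0 d)]
      _ ≤ Real.exp (Real.log ((g.eval (k : ℤ)).natAbs : ℝ)) := Real.exp_le_exp.mpr (by rw [hd]; linarith)
      _ = ((g.eval (k : ℤ)).natAbs : ℝ) := Real.exp_log (hNpos k)
  set N : ℝ := ((g.eval (m : ℤ)).natAbs : ℝ) with hN
  set N' : ℝ := ((g.eval ((m : ℤ) + 1)).natAbs : ℝ) with hN'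
  have hNp : 0 < N := hNpos m
  have hN'p : 0 < N' := by have := hNpos (m + 1); push_cast at this; exact this
  have hmin : Real.exp (-B) * (m : ℝ) ^ d ≤ min N N' := by
    refine le_min (hlow m hm) ?_
    have h1 := hlow (m + 1) (by omega)
    push_cast at h1
    refine le_trans (mul_le_mul_of_nonneg_left ?_ (Real.exp_pos _).le) h1
    exact pow_le_pow_left₀ hm0.le (by linarith) d
  have hminpos : 0 < Real.exp (-B) * (m : ℝ) ^ d := by positivity
  -- the increment
  have hinc : |N' - N| ≤ A * ((m : ℝ) + 1) ^ (d - 1) := by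
    have h1 := abs_eval_succ_sub_eval_le g m
    rw [hN, hN', natCast_natAbs_eval, show ((m : ℤ) + 1 : ℤ) = ((m + 1 : ℕ) : ℤ) by push_cast; ring,
      natCast_natAbs_eval]
    push_cast
    refine (abs_abs_sub_abs_le_abs_sub _ _).trans ?_
    rw [hA]
    exact h1
  have hstep : |Real.log N' - Real.log N| ≤ A * ((m : ℝ) + 1) ^ (d - 1) / (Real.exp (-B) * (m : ℝ) ^ d) := by
    refine (Literature.Topology.FourManifolds.abs_log_sub_log_le' hN'p hNp).trans ?_
    rw [min_comm]
    calc |N' - N| / min N N' ≤ |N' - N| / (Real.exp (-B) * (m : ℝ) ^ d) :=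
          div_le_div_of_nonneg_left (abs_nonneg _) hminpos hmin
      _ ≤ A * ((m : ℝ) + 1) ^ (d - 1) / (Real.exp (-B) * (m : ℝ) ^ d) :=
          div_le_div_of_nonneg_right hinc hminpos.le
  refine hstep.trans ?_
  -- `(m+1)^{d-1} ≤ 2^{d-1} m^{d-1}` and `m^d = m^{d-1}·m`
  have hd1 : d = (d - 1) + 1 := by omega
  have h2m : ((m : ℝ) + 1) ^ (d - 1) ≤ (2 : ℝ) ^ (d - 1) * (m : ℝ) ^ (d - 1) := by
    rw [← mul_pow]
    exact pow_le_pow_left₀ (by positivity) (by linarith [show (1 : ℝ) ≤ m by exact_mod_cast hm]) _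
  rw [div_le_div_iff₀ hminpos hm0, Real.exp_neg]
  have hmd : (m : ℝ) ^ d = (m : ℝ) ^ (d - 1) * m := by rw [hd1, pow_succ]; congr 1
  rw [hmd]
  have hexp : 0 < Real.exp B := Real.exp_pos B
  have hm1 : 0 ≤ (m : ℝ) ^ (d - 1) := by positivity
  calc A * ((m : ℝ) + 1) ^ (d - 1) * m ≤ A * ((2 : ℝ) ^ (d - 1) * (m : ℝ) ^ (d - 1)) * m := by
        refine mul_le_mul_of_nonneg_right (mul_le_mul_of_nonneg_left h2m hA0) hm0.le
    _ = A * Real.exp B * 2 ^ (d - 1) * ((Real.exp B)⁻¹ * ((m : ℝ) ^ (d - 1) * m)) := by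
        field_simp
    _ ≤ _ := le_rfl

/-- **The `m`-differences of the smooth weights are `≪ 1/m`**: for `g` irreducible of degree `≥ 2`, `Δ > 0`:
`|a_e(m+1) − a_e(m)| ≤ C_g/(4Δm)` for all `e` and all `m ≥ 1`. [this work] -/
theorem exists_abs_locWeight_succ_sub_le {g : ℤ[X]} (hirr : Irreducible g) (hdeg : 2 ≤ g.natDegree)
    {Δ : ℝ} (hΔ : 0 < Δ) :
    ∃ C : ℝ, ∀ e m : ℕ, 1 ≤ m → |locWeight g Δ e (m + 1) - locWeight g Δ e m| ≤ C / m := by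
  obtain ⟨C, hC⟩ := exists_abs_log_natAbs_succ_sub_le hirr hdeg
  refine ⟨C / (4 * Δ), fun e m hm => ?_⟩
  have hz : ∀ k : ℕ, g.eval (k : ℤ) ≠ 0 := fun k => eval_natCast_ne_zero_of_irreducible hirr hdeg k
  have h1 := abs_locWeight_sub_le g hΔ e (hz m) (hz (m + 1))
  have h2 := hC m hm
  push_cast at h1 h2
  calc |locWeight g Δ e (m + 1) - locWeight g Δ e m|
      ≤ |Real.log ((g.eval ((m : ℤ) + 1)).natAbs : ℝ) - Real.log ((g.eval (m : ℤ)).natAbs : ℝ)| / (4 * Δ) := h1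
    _ ≤ C / m / (4 * Δ) := div_le_div_of_nonneg_right h2 (by positivity)
    _ = C / (4 * Δ) / m := by ring

/-! ### Unimodality of `e ↦ a_e(m') − a_e(m)` and its total variation -/

/-- The clamp `u ↦ max(0, min(1, u))`: sliding-window overlaps shrink to the right of `0`:
`0 ≤ σ`, `0 ≤ t₁ ≤ t₂` ⇒ `cl(t₂+σ) − cl(t₂) ≤ cl(t₁+σ) − cl(t₁)`. [folklore] -/
theorem clamp_window_antitone {σ t₁ t₂ : ℝ} (hσ : 0 ≤ σ) (ht₁ : 0 ≤ t₁) (h : t₁ ≤ t₂) :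
    max 0 (min 1 (t₂ + σ)) - max 0 (min 1 t₂) ≤ max 0 (min 1 (t₁ + σ)) - max 0 (min 1 t₁) := by
  rw [max_eq_right (le_min zero_le_one (by linarith : 0 ≤ t₂ + σ)),
    max_eq_right (le_min zero_le_one (by linarith : 0 ≤ t₂)),
    max_eq_right (le_min zero_le_one (by linarith : 0 ≤ t₁ + σ)),
    max_eq_right (le_min zero_le_one ht₁)]
  simp only [min_def]
  split_ifs <;> linarith

/-- … and grow to the left of `0`: `0 ≤ σ`, `t₁ ≤ t₂ ≤ 0` ⇒ `cl(t₁+σ) − cl(t₁) ≤ cl(t₂+σ) − cl(t₂)`. [folklore] -/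
theorem clamp_window_monotone {σ t₁ t₂ : ℝ} (h : t₁ ≤ t₂) (ht₂ : t₂ ≤ 0) :
    max 0 (min 1 (t₁ + σ)) - max 0 (min 1 t₁) ≤ max 0 (min 1 (t₂ + σ)) - max 0 (min 1 t₂) := by
  rw [max_eq_left ((min_le_right _ _).trans (h.trans ht₂)), max_eq_left ((min_le_right _ _).trans ht₂),
    sub_zero, sub_zero]
  exact clamp_mono (by linarith)

/-- The clamp parameter of `a_e(m)`: `t_e(m) = (Δ − (log e − log √|g(m)|))/(2Δ)`. [this work] -/
noncomputable def locParam (g : ℤ[X]) (Δ : ℝ) (e m : ℕ) : ℝ :=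
  (Δ - (Real.log e - Real.log (sqrtAbsEval g m))) / (2 * Δ)

/-- `a_e(m) = cl(t_e(m))` for `e ≥ 1`, `g(m) ≠ 0`. [this work] -/
theorem locWeight_eq_clamp_locParam (g : ℤ[X]) (Δ : ℝ) {e m : ℕ} (he : 1 ≤ e) (hm : g.eval (m : ℤ) ≠ 0) :
    locWeight g Δ e m = max 0 (min 1 (locParam g Δ e m)) := by
  unfold locWeight hypWeight locParam
  have he0 : (e : ℝ) ≠ 0 := by exact_mod_cast (by omega : e ≠ 0)
  rw [Real.log_div he0 (sqrtAbsEval_pos g hm).ne']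

/-- The parameter shift between two indices is independent of `e`:
`t_e(m') = t_e(m) + (log √|g(m')| − log √|g(m)|)/(2Δ)`. [this work] -/
theorem locParam_eq_add (g : ℤ[X]) (Δ : ℝ) (e m m' : ℕ) :
    locParam g Δ e m' = locParam g Δ e m
      + (Real.log (sqrtAbsEval g m') - Real.log (sqrtAbsEval g m)) / (2 * Δ) := by
  unfold locParam
  ring

/-- The shift is `≥ 0` when `|g(m)| ≤ |g(m')|`. [this work] -/
theorem locParam_shift_nonneg (g : ℤ[X]) {Δ : ℝ} (hΔ : 0 < Δ) {m m' : ℕ} (hm : g.eval (m : ℤ) ≠ 0)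
    (hle : (g.eval (m : ℤ)).natAbs ≤ (g.eval (m' : ℤ)).natAbs) :
    0 ≤ (Real.log (sqrtAbsEval g m') - Real.log (sqrtAbsEval g m)) / (2 * Δ) := by
  refine div_nonneg (sub_nonneg.mpr (Real.log_le_log (sqrtAbsEval_pos g hm) ?_)) (by positivity)
  unfold sqrtAbsEval
  exact Real.sqrt_le_sqrt (by exact_mod_cast hle)

/-- `t_e(m)` is antitone in `e ≥ 1`. [this work] -/
theorem locParam_antitone (g : ℤ[X]) {Δ : ℝ} (hΔ : 0 < Δ) (m : ℕ) {e₁ e₂ : ℕ} (he₁ : 1 ≤ e₁) (h : e₁ ≤ e₂) :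
    locParam g Δ e₂ m ≤ locParam g Δ e₁ m := by
  unfold locParam
  have : Real.log (e₁ : ℝ) ≤ Real.log e₂ :=
    Real.log_le_log (by exact_mod_cast he₁) (by exact_mod_cast h)
  refine div_le_div_of_nonneg_right ?_ (by positivity)
  linarith

/-- `t_e(m) ≥ 0` for `1 ≤ e ≤ e^Δ·√|g(m)|`. [this work] -/
theorem locParam_nonneg (g : ℤ[X]) {Δ : ℝ} (hΔ : 0 < Δ) {e m : ℕ} (he : 1 ≤ e) (hm : g.eval (m : ℤ) ≠ 0)
    (hle : (e : ℝ) ≤ Real.exp Δ * sqrtAbsEval g m) : 0 ≤ locParam g Δ e m := by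
  unfold locParam
  have he0 : (0 : ℝ) < e := by exact_mod_cast he
  have h1 : Real.log (e : ℝ) ≤ Δ + Real.log (sqrtAbsEval g m) := by
    have := Real.log_le_log he0 hle
    rwa [Real.log_mul (Real.exp_pos Δ).ne' (sqrtAbsEval_pos g hm).ne', Real.log_exp] at this
  exact div_nonneg (by linarith) (by positivity)

/-- `t_e(m) ≤ 0` for `e ≥ e^Δ·√|g(m)|`. [this work] -/
theorem locParam_nonpos (g : ℤ[X]) {Δ : ℝ} (hΔ : 0 < Δ) {e m : ℕ} (hm : g.eval (m : ℤ) ≠ 0)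
    (hle : Real.exp Δ * sqrtAbsEval g m ≤ e) : locParam g Δ e m ≤ 0 := by
  unfold locParam
  have hP : 0 < Real.exp Δ * sqrtAbsEval g m := mul_pos (Real.exp_pos Δ) (sqrtAbsEval_pos g hm)
  have h1 : Δ + Real.log (sqrtAbsEval g m) ≤ Real.log (e : ℝ) := by
    have := Real.log_le_log hP hle
    rwa [Real.log_mul (Real.exp_pos Δ).ne' (sqrtAbsEval_pos g hm).ne', Real.log_exp] at this
  exact div_nonpos_of_nonpos_of_nonneg (by linarith) (by positivity)

/-- **Unimodality, rising part**: for `|g(m)| ≤ |g(m')|` the difference `e ↦ a_e(m') − a_e(m)` is nondecreasing on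
`1 ≤ e ≤ e^Δ√|g(m)|`. [this work] -/
theorem locWeight_sub_mono_left (g : ℤ[X]) {Δ : ℝ} (hΔ : 0 < Δ) {m m' : ℕ} (hm : g.eval (m : ℤ) ≠ 0)
    (hm' : g.eval (m' : ℤ) ≠ 0) (hle : (g.eval (m : ℤ)).natAbs ≤ (g.eval (m' : ℤ)).natAbs) {e₁ e₂ : ℕ}
    (he₁ : 1 ≤ e₁) (h : e₁ ≤ e₂) (he₂ : (e₂ : ℝ) ≤ Real.exp Δ * sqrtAbsEval g m) :
    locWeight g Δ e₁ m' - locWeight g Δ e₁ m ≤ locWeight g Δ e₂ m' - locWeight g Δ e₂ m := by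
  rw [locWeight_eq_clamp_locParam g Δ he₁ hm, locWeight_eq_clamp_locParam g Δ he₁ hm',
    locWeight_eq_clamp_locParam g Δ (he₁.trans h) hm, locWeight_eq_clamp_locParam g Δ (he₁.trans h) hm',
    locParam_eq_add g Δ e₁ m m', locParam_eq_add g Δ e₂ m m']
  exact clamp_window_antitone (locParam_shift_nonneg g hΔ hm hle)
    (locParam_nonneg g hΔ (he₁.trans h) hm he₂) (locParam_antitone g hΔ m he₁ h)

/-- **Unimodality, falling part**: for `|g(m)| ≤ |g(m')|` the difference `e ↦ a_e(m') − a_e(m)` is nonincreasing on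
`e ≥ e^Δ√|g(m)|`. [this work] -/
theorem locWeight_sub_anti_right (g : ℤ[X]) {Δ : ℝ} (hΔ : 0 < Δ) {m m' : ℕ} (hm : g.eval (m : ℤ) ≠ 0)
    (hm' : g.eval (m' : ℤ) ≠ 0) {e₁ e₂ : ℕ} (he₁ : Real.exp Δ * sqrtAbsEval g m ≤ e₁) (h : e₁ ≤ e₂) :
    locWeight g Δ e₂ m' - locWeight g Δ e₂ m ≤ locWeight g Δ e₁ m' - locWeight g Δ e₁ m := by
  have hP : 0 < Real.exp Δ * sqrtAbsEval g m := mul_pos (Real.exp_pos Δ) (sqrtAbsEval_pos g hm)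
  have he₁' : 1 ≤ e₁ := by
    have : (0 : ℝ) < e₁ := hP.trans_le he₁
    exact_mod_cast (show 0 < e₁ by exact_mod_cast this)
  rw [locWeight_eq_clamp_locParam g Δ he₁' hm, locWeight_eq_clamp_locParam g Δ he₁' hm',
    locWeight_eq_clamp_locParam g Δ (he₁'.trans h) hm, locWeight_eq_clamp_locParam g Δ (he₁'.trans h) hm',
    locParam_eq_add g Δ e₁ m m', locParam_eq_add g Δ e₂ m m']
  exact clamp_window_monotone (locParam_antitone g hΔ m he₁' h) (locParam_nonpos g hΔ hm he₁)

/-- Telescoping over `[a, b)`. [folklore] -/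
theorem sum_Ico_succ_sub (f : ℕ → ℝ) {a b : ℕ} (hab : a ≤ b) :
    ∑ e ∈ Ico a b, (f (e + 1) - f e) = f b - f a := by
  induction b, hab using Nat.le_induction with
  | base => simp
  | succ k hk ih => rw [sum_Ico_succ_top hk, ih]; ring

/-- **Total variation of a nonnegative unimodal sequence**: if `0 ≤ f ≤ M` on `[a, b]`, `f` is nondecreasing on
`[a, p]` and nonincreasing on `[p+1, b]`, then `∑_{a≤e<b} |f(e+1) − f(e)| ≤ 3M`. [folklore] -/
theorem sum_abs_succ_sub_le_of_unimodal (f : ℕ → ℝ) {a b p : ℕ} {M : ℝ} (hM0 : 0 ≤ M)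
    (hf : ∀ e, a ≤ e → e ≤ b → 0 ≤ f e ∧ f e ≤ M)
    (hinc : ∀ e₁ e₂, a ≤ e₁ → e₁ ≤ e₂ → e₂ ≤ p → e₂ ≤ b → f e₁ ≤ f e₂)
    (hdec : ∀ e₁ e₂, p < e₁ → e₁ ≤ e₂ → a ≤ e₁ → e₂ ≤ b → f e₂ ≤ f e₁) :
    ∑ e ∈ Ico a b, |f (e + 1) - f e| ≤ 3 * M := by
  rcases lt_or_ge b a with hba | hab
  · rw [Ico_eq_empty (by omega), sum_empty]
    linarith
  -- termwise split into rising, straddling and falling parts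
  have hterm : ∀ e ∈ Ico a b, |f (e + 1) - f e|
      ≤ (if e < p then f (e + 1) - f e else 0) + (if e = p then M else 0)
        + (if p < e then f e - f (e + 1) else 0) := by
    intro e he
    rw [mem_Ico] at he
    rcases lt_trichotomy e p with hlt | heq | hgt
    · rw [if_pos hlt, if_neg hlt.ne, if_neg (by omega), add_zero, add_zero]
      rw [abs_of_nonneg (sub_nonneg.mpr (hinc e (e + 1) he.1 (by omega) (by omega) (by omega)))]
    · subst heq
      rw [if_neg (lt_irrefl _), if_pos rfl, if_neg (lt_irrefl _), zero_add, add_zero]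
      have h1 := hf e he.1 (by omega)
      have h2 := hf (e + 1) (by omega) (by omega)
      rw [abs_le]; constructor <;> linarith [h1.1, h1.2, h2.1, h2.2]
    · rw [if_neg (by omega), if_neg (by omega), if_pos hgt, zero_add, zero_add]
      rw [abs_sub_comm, abs_of_nonneg (sub_nonneg.mpr (hdec e (e + 1) hgt (by omega) he.1 (by omega)))]
  refine (sum_le_sum hterm).trans ?_
  rw [sum_add_distrib, sum_add_distrib]
  -- rising part
  have hrise : ∑ e ∈ Ico a b, (if e < p then f (e + 1) - f e else 0) ≤ M := by
    rw [← sum_filter, Ico_filter_lt]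
    rcases lt_or_ge (min b p) a with h | h
    · rw [Ico_eq_empty (by omega), sum_empty]; exact hM0
    · rw [sum_Ico_succ_sub f h]
      have h1 := hf (min b p) h (min_le_left _ _)
      have h2 := hf a le_rfl hab
      linarith [h1.2, h2.1]
  -- straddle
  have hmid : ∑ e ∈ Ico a b, (if e = p then M else 0) ≤ M := by
    rw [sum_ite_eq']
    split_ifs
    · exact le_rfl
    · exact hM0
  -- falling part
  have hfall : ∑ e ∈ Ico a b, (if p < e then f e - f (e + 1) else 0) ≤ M := by
    rw [← sum_filter]
    have hflt : (Ico a b).filter (fun e => p < e) = Ico (max a (p + 1)) b := by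
      ext e
      simp only [mem_filter, mem_Ico, max_le_iff]
      omega
    rw [hflt]
    rcases lt_or_ge b (max a (p + 1)) with h | h
    · rw [Ico_eq_empty (by omega), sum_empty]; exact hM0
    · have htel := sum_Ico_succ_sub f h
      have hneg : ∑ e ∈ Ico (max a (p + 1)) b, (f e - f (e + 1)) = f (max a (p + 1)) - f b := by
        rw [← neg_inj, ← sum_neg_distrib, neg_sub]
        rw [← htel]
        exact sum_congr rfl fun e _ => by ring
      rw [hneg]
      have h1 := hf (max a (p + 1)) (le_max_left _ _) h
      have h2 := hf b hab le_rfl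
      linarith [h1.2, h2.1]
  linarith

/-- **TOTAL VARIATION OF THE `m`-DIFFERENCES IN THE MODULUS.**  For `g(m), g(m') ≠ 0`, `Δ > 0` and any range of
moduli `1 ≤ a ≤ e < b`: `∑_{a≤e<b} |(a_{e+1}(m') − a_{e+1}(m)) − (a_e(m') − a_e(m))| ≤ 3·|log|g(m')| − log|g(m)||/(4Δ)`.
[this work] -/
theorem sum_abs_locWeight_sub_diff_le (g : ℤ[X]) {Δ : ℝ} (hΔ : 0 < Δ) {m m' : ℕ} (hm : g.eval (m : ℤ) ≠ 0)
    (hm' : g.eval (m' : ℤ) ≠ 0) {a b : ℕ} (ha : 1 ≤ a) :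
    ∑ e ∈ Ico a b, |(locWeight g Δ (e + 1) m' - locWeight g Δ (e + 1) m) - (locWeight g Δ e m' - locWeight g Δ e m)|
      ≤ 3 * (|Real.log ((g.eval (m' : ℤ)).natAbs : ℝ) - Real.log ((g.eval (m : ℤ)).natAbs : ℝ)| / (4 * Δ)) := by
  -- reduce to `|g(m)| ≤ |g(m')|`
  wlog hle : (g.eval (m : ℤ)).natAbs ≤ (g.eval (m' : ℤ)).natAbs generalizing m m'
  · have h := this hm' hm (le_of_not_ge hle)
    rw [abs_sub_comm] at h
    refine le_trans (le_of_eq (sum_congr rfl fun e _ => ?_)) h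
    rw [abs_sub_comm]
    congr 1
    ring
  set f : ℕ → ℝ := fun e => locWeight g Δ e m' - locWeight g Δ e m with hf
  set M : ℝ := |Real.log ((g.eval (m' : ℤ)).natAbs : ℝ) - Real.log ((g.eval (m : ℤ)).natAbs : ℝ)| / (4 * Δ)
  set p : ℕ := ⌊Real.exp Δ * sqrtAbsEval g m⌋₊ with hp
  have hP0 : 0 ≤ Real.exp Δ * sqrtAbsEval g m := (mul_pos (Real.exp_pos Δ) (sqrtAbsEval_pos g hm)).le
  have hbound : ∀ e, a ≤ e → e ≤ b → 0 ≤ f e ∧ f e ≤ M := fun e _ _ =>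
    ⟨sub_nonneg.mpr (locWeight_mono g hΔ e hm hle), (le_abs_self _).trans (abs_locWeight_sub_le g hΔ e hm hm')⟩
  have hinc : ∀ e₁ e₂, a ≤ e₁ → e₁ ≤ e₂ → e₂ ≤ p → e₂ ≤ b → f e₁ ≤ f e₂ := by
    intro e₁ e₂ h₁ h₁₂ h₂ _
    have he₂ : (e₂ : ℝ) ≤ Real.exp Δ * sqrtAbsEval g m :=
      le_trans (by exact_mod_cast h₂) (Nat.floor_le hP0)
    exact locWeight_sub_mono_left g hΔ hm hm' hle (ha.trans h₁) h₁₂ he₂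
  have hdec : ∀ e₁ e₂, p < e₁ → e₁ ≤ e₂ → a ≤ e₁ → e₂ ≤ b → f e₂ ≤ f e₁ := by
    intro e₁ e₂ h₁ h₁₂ _ _
    have he₁ : Real.exp Δ * sqrtAbsEval g m ≤ e₁ := (Nat.lt_of_floor_lt h₁).le
    exact locWeight_sub_anti_right g hΔ hm hm' he₁ h₁₂
  exact sum_abs_succ_sub_le_of_unimodal f (by positivity) hbound hinc hdec

end Summit.Parity.BatemanHorn.Theorems
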